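import Summits.AnomalousDissipation.AnomalousDissipation.Theorems.BaireTransferRobustLoudUpgradeLaminarA

/-!
# The laminar instance of the line `malkin-cone-group-orbits` (crux stmt-AnomalousDissipation-1144,
# `BaireTransfer.RobustLoudUpgrade`), part B: upgrade at the Kolmogorov point, at every Grashof number

Two registered sub-goals of the crux (the refuter's named weakest obligations, Disproof §6), now
consequences of (G1) `Laminar.kolmogorov_not_isLinNSEigenvalue` (part A) and the LANDED steady stubs
`SteadyPersist.stub_steadyPersist : nondegSteady ⊆ persistSteady`,
`SteadyWindow.stub_steadyWindow : persistSteady ⊆ interior loud`: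

* `upgradeAtLaminar` (G2) — `cLam S A ∈ interior LOUD^{(0,a)}(S, 2E_lam, ε_lam/2)` for `k₀ ∈ S`, `A > 0`,
  `0 < ν < a`: the laminar state `sh (A/(4π²ν))` is a mean-zero classical steady state of `f_{cLam A}` with
  budgets exactly `(E_lam, ε_lam)` and no classical kernel, i.e. `cLam S A ∈ nondegSteady` at the relaxed
  budgets;
* `sharpUpgradeAtLaminar` (G3) — `cLam S A ∈ closure (interior LOUD^{(0,a)}(S, E_lam, ε_lam))` at the SHARP
  budgets: the points `θ • cLam S A = cLam S (θA)`, `θ ↓ 1`, are nondegenerate laminar witnesses at the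
  viscosities `ν' = θ(1+θ)ν/2 ∈ (θν, θ²ν)` with strictly better budgets (compare Disproof §6
  `smul_cLam_not_mem_loud`: for `θ < 1` the ray is quiet — `cLam S A` is a boundary point of
  `interior LOUD` at sharp budgets, the sharpest possible form of force-openness at the laminar point).

References: Temam, *Navier–Stokes Equations* (1979) Ch. II §1; the vocabulary module
`Theorems/BaireTransferRobustLoudUpgradeLine.lean`; `Cruxes/RobustLoudUpgrade/Disproof.lean` §6.
-/

-- `Summit.<Summit>.<Problem>` is the tree's mandated summit-side namespace (CONVENTIONS §2); for this
-- single-conjunct summit the two coincide, so the duplicate is deliberate.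
set_option linter.dupNamespace false

noncomputable section

open scoped BigOperators Topology ENNReal
open Filter Set Function TopologicalSpace MeasureTheory UnitAddTorus

namespace Summit.AnomalousDissipation.AnomalousDissipation.Theorems.RobustLoudUpgrade.Laminar

open Literature.Analysis.FunctionSpaces Literature.Analysis.FunctionSpaces.Torus
open Literature.Analysis.FluidPDE
open Summit.AnomalousDissipation.AnomalousDissipation.Theses.BaireTransfer

variable {S : Finset (Fin 3 → ℤ)}

/-! ## §1 (G2) Upgrade at the laminar point with relaxed budgets: `upgradeAtLaminar` -/

/-- `E_lam > 0` for `A ≠ 0`, `ν ≠ 0`. [folklore] -/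
theorem Elam_pos {A ν : ℝ} (hA : A ≠ 0) (hν : ν ≠ 0) : 0 < Elam A ν := by
  unfold Elam
  have : A / (4 * Real.pi ^ 2 * ν) ≠ 0 := by positivity
  positivity

-- adapted from Cruxes/RobustLoudUpgrade/Disproof.lean §6
/-- `ε_lam > 0` for `A ≠ 0`, `ν > 0`. [folklore] -/
theorem εlam_pos {A ν : ℝ} (hA : A ≠ 0) (hν : 0 < ν) : 0 < εlam A ν := by
  unfold εlam
  have : A / (4 * Real.pi ^ 2 * ν) ≠ 0 := by positivity
  positivity

/-- **The laminar coefficient vector is a nondegenerate steady witness** at viscosity `ν ∈ (0,a)` for all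
budgets `E > E_lam(A,ν)`, `ε < ε_lam(A,ν)`. [folklore] -/
theorem cLam_mem_nondegSteady (hS : k₀ ∈ S) {A ν a E ε : ℝ} (hν : 0 < ν) (hνa : ν < a)
    (hE : Elam A ν < E) (hε : ε < εlam A ν) : cLam S A ∈ nondegSteady S a E ε := by
  refine ⟨ν, hν, hνa, sh (A / (4 * Real.pi ^ 2 * ν)), fun _ => 0, lam_isClassical hS hν.ne' A,
    hasZeroMean_sh_lam hS A ν, ?_, ?_, kolmogorov_not_isLinNSEigenvalue ν _ hν.ne'⟩
  · rw [meanEnergy_sh]; exact hE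
  · rw [meanDissipation_sh]; exact hε

/-- **(G2) Upgrade at the laminar point, relaxed budgets**: `cLam S A ∈ interior LOUD^{(0,a)}(S, 2E_lam, ε_lam/2)`
for `k₀ ∈ S`, `A > 0`, `0 < ν < a` — by (G1) the laminar witness is nondegenerate, and
`nondegSteady ⊆ persistSteady ⊆ interior loud` (landed stubs). [folklore] -/
theorem upgradeAtLaminar : ∀ (S : Finset (Fin 3 → ℤ)), k₀ ∈ S → ∀ (A ν a : ℝ), 0 < A → 0 < ν → ν < a → cLam S A ∈ interior (loud S a (2 * Elam A ν) (εlam A ν / 2)) := by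
  intro S hS A ν a hA hν hνa
  have hE : Elam A ν < 2 * Elam A ν := by linarith [Elam_pos hA.ne' hν.ne']
  have hε : εlam A ν / 2 < εlam A ν := by linarith [εlam_pos hA.ne' hν]
  exact SteadyWindow.stub_steadyWindow S a _ _
    (SteadyPersist.stub_steadyPersist S a _ _ (cLam_mem_nondegSteady hS hν hνa hE hε))

/-! ## §2 (G3) Upgrade at the laminar point with SHARP budgets: `sharpUpgradeAtLaminar` -/

/-- Budgets along the ray: at amplitude `θA` and viscosity `ν' > θν`, the laminar energy is below
`E_lam(A,ν)`. [folklore] -/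
theorem Elam_lt {A ν ν' θ : ℝ} (hA : 0 < A) (hν : 0 < ν) (hθ : 0 < θ) (h : θ * ν < ν') :
    Elam (θ * A) ν' < Elam A ν := by
  have hν' : 0 < ν' := lt_trans (mul_pos hθ hν) h
  unfold Elam
  have h1 : θ * A / (4 * Real.pi ^ 2 * ν') < A / (4 * Real.pi ^ 2 * ν) := by
    rw [div_lt_div_iff₀ (by positivity) (by positivity)]
    have : A * (4 * Real.pi ^ 2) * (θ * ν) < A * (4 * Real.pi ^ 2) * ν' :=
      mul_lt_mul_of_pos_left h (by positivity)
    nlinarith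
  have h0 : 0 ≤ θ * A / (4 * Real.pi ^ 2 * ν') := by positivity
  have h2 := pow_lt_pow_left₀ h1 h0 two_ne_zero
  linarith

/-- Budgets along the ray: at amplitude `θA` and viscosity `ν' < θ²ν`, the laminar dissipation is above
`ε_lam(A,ν)`. [folklore] -/
theorem εlam_lt {A ν ν' θ : ℝ} (hA : 0 < A) (hν : 0 < ν) (hν' : 0 < ν') (h : ν' < θ ^ 2 * ν) :
    εlam A ν < εlam (θ * A) ν' := by
  unfold εlam
  have e1 : ν * (2 * Real.pi ^ 2 * (A / (4 * Real.pi ^ 2 * ν)) ^ 2) = A ^ 2 / (8 * Real.pi ^ 2) / ν := by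
    field_simp; ring
  have e2 : ν' * (2 * Real.pi ^ 2 * (θ * A / (4 * Real.pi ^ 2 * ν')) ^ 2) =
      A ^ 2 / (8 * Real.pi ^ 2) * θ ^ 2 / ν' := by
    field_simp; ring
  rw [e1, e2, div_lt_div_iff₀ hν hν']
  have hc : 0 < A ^ 2 / (8 * Real.pi ^ 2) := by positivity
  nlinarith [mul_lt_mul_of_pos_left h hc]

/-- **(G3) Upgrade at the laminar point, SHARP budgets**: `cLam S A ∈ closure (interior LOUD^{(0,a)}(S, E_lam, ε_lam))`
for `k₀ ∈ S`, `A > 0`, `0 < ν < a`.  For `θ > 1` with `θ²ν < a`, `θ • cLam S A = cLam S (θA)` carries the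
nondegenerate laminar state at viscosity `ν' = θ(1+θ)ν/2 ∈ (θν, θ²ν)`, whose budgets beat `(E_lam, ε_lam)`
strictly (`Elam_lt`, `εlam_lt`), so it lies in `interior loud` by (G1) and the landed steady stubs; let
`θ ↓ 1`. [folklore] -/
theorem sharpUpgradeAtLaminar : ∀ (S : Finset (Fin 3 → ℤ)), k₀ ∈ S → ∀ (A ν a : ℝ), 0 < A → 0 < ν → ν < a → cLam S A ∈ closure (interior (loud S a (Elam A ν) (εlam A ν))) := by
  intro S hS A ν a hA hν hνa
  -- the ray beyond the laminar point is robustly loud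
  have key : ∀ θ : ℝ, 1 < θ → θ ^ 2 * ν < a →
      θ • cLam S A ∈ interior (loud S a (Elam A ν) (εlam A ν)) := by
    intro θ hθ hθa
    have hθ0 : 0 < θ := by linarith
    set ν' : ℝ := θ * ν * (1 + θ) / 2 with hν'
    have h1 : θ * ν < ν' := by rw [hν']; nlinarith [mul_pos hθ0 hν]
    have h2 : ν' < θ ^ 2 * ν := by rw [hν']; nlinarith [mul_pos hθ0 hν]
    have hν'0 : 0 < ν' := lt_trans (mul_pos hθ0 hν) h1
    have hν'a : ν' < a := h2.trans hθa
    rw [← cLam_smul]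
    exact SteadyWindow.stub_steadyWindow S a _ _ (SteadyPersist.stub_steadyPersist S a _ _
      (cLam_mem_nondegSteady hS hν'0 hν'a (Elam_lt hA hν hθ0 h1) (εlam_lt hA hν hν'0 h2)))
  -- and it accumulates at the laminar point
  have hcont : Tendsto (fun θ : ℝ => θ • cLam S A) (𝓝[>] 1) (𝓝 (cLam S A)) := by
    have : Tendsto (fun θ : ℝ => θ • cLam S A) (𝓝 1) (𝓝 ((1 : ℝ) • cLam S A)) :=
      (continuous_id.smul continuous_const).tendsto 1
    rw [one_smul] at this
    exact this.mono_left nhdsWithin_le_nhds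
  have hev : ∀ᶠ θ in 𝓝[>] (1 : ℝ), θ • cLam S A ∈ interior (loud S a (Elam A ν) (εlam A ν)) := by
    have hlt : ∀ᶠ θ in 𝓝 (1 : ℝ), θ ^ 2 * ν < a := by
      have ht : Tendsto (fun θ : ℝ => θ ^ 2 * ν) (𝓝 1) (𝓝 ((1 : ℝ) ^ 2 * ν)) :=
        ((continuous_pow 2).mul continuous_const).tendsto 1
      exact ht.eventually_lt tendsto_const_nhds (by simpa using hνa)
    have hgt : ∀ᶠ θ in 𝓝[>] (1 : ℝ), 1 < θ := eventually_nhdsWithin_of_forall fun θ hθ => hθ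
    filter_upwards [hgt, hlt.filter_mono nhdsWithin_le_nhds] with θ hθ hθa
    exact key θ hθ hθa
  exact mem_closure_of_tendsto hcont hev

end Summit.AnomalousDissipation.AnomalousDissipation.Theorems.RobustLoudUpgrade.Laminar

end
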